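import Literature.AlgebraicGeometry.Resolution.AlterationsFibresConnected
import Literature.AlgebraicGeometry.Resolution.AlterationsLemma411Vertex
import Literature.AlgebraicGeometry.Resolution.AlterationsLemma411VertexBlowupHolds
import Literature.AlgebraicGeometry.Resolution.AlterationsLemma411Blowup
import Literature.AlgebraicGeometry.Resolution.AlterationsLemma411FibreDimension
import Literature.AlgebraicGeometry.Resolution.AlterationsLemma411SmoothLocus
import Literature.AlgebraicGeometry.Resolution.AlterationsSmoothOverOpenHolds
import Literature.AlgebraicGeometry.Resolution.AlterationsBlowupDivisorProofs
import Literature.AlgebraicGeometry.Motives.ProjectiveOfGeneratingSections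
import Mathlib.AlgebraicGeometry.Morphisms.QuasiFinite
import HarnessLib

/-!
# De Jong's alteration theorem: 4.11–4.12 over the Stein base — `π₁(ℙ^{d-1}) = 0` circumvented

Topic: `Literature/AlgebraicGeometry/Resolution`. Pure proofs, no new named fact. The named fact
`DeJong1996FibrationReduction` (`AlterationsFibrations.lean`; de Jong 1996, Lemma 4.11 with 4.12:
a normal projective pair `(X, Z)` over an algebraically closed field is dominated along a
generically étale alteration `φ : X' → X` by a pair `(X', φ⁻¹Z)` in situation (vi),
`DeJong1996.SituationVI`) is assembled in the tree (`DeJong1996FibrationReduction.of_lemma411`,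
`…of_lemma411_of_steinEtale`, `…of_printedLeaves`, `…of_openLeaves`) exactly along the printed
text of 4.12, whose last step reads

> "Let `X' → Y' → ℙ^{d-1}` be the Stein factorization of `f`. Note that `Y' → ℙ^{d-1}` is
> (finite) étale, in view of property (ii) b) of the lemma (cf. [18]). (The reader may circumvent
> this result by replacing `ℙ^{d-1}` by `Y'`.) We conclude that `Y' = ℙ^{d-1}`, hence all fibres
> of `f` are geometrically connected."

and therefore carries `π₁(ℙ^{d-1}_k) = 0` (SGA 1 XI 1.1: `ProjectiveSpaceSimplyConnected`, reduced
in the tree to `ProjectiveLineSimplyConnected` — proved — and the named fact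
`EtaleCoverHyperplaneSectionConnected`) in its trust base. This file carries out the
parenthetical remark of the source instead: situation (vi) only asks for "a morphism `f : X → Y`
of projective varieties" with (vi) a)–d), and the Stein base `Y'` serves. Precisely, with
`X' → Y' → ℙ^d` Mathlib's relative normalization `f = f.toNormalization ≫ f.fromNormalization`
(Stacks 035H/03H0), `π = f.fromNormalization` finite étale (`DeJong1996SteinFactorizationEtale`)
and `f' = f.toNormalization` with geometrically connected fibres (Zariski's connectedness theorem,
`steinFactorization_geometricallyConnected`):

* `Y'` is integral (Mathlib) and projective over `k` — finite over `ℙ^d_k`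
  (`Motives.isProjectiveOver_of_isFinite`, Görtz–Wedhorn I 13.84);
* the fibre `f'⁻¹(y')` is open and closed in `f⁻¹(π y')` (`π` is quasi-finite, so `π⁻¹(π y')`
  is discrete), whence its irreducible components are irreducible components of `f⁻¹(π y')`
  (`DeJong1996.exists_mem_irreducibleComponents_fiber_comp`) — (vi) a) "equidimensional of
  dimension 1" passes from `f` to `f'`, and so does (vi) b), because the smooth locus only
  grows: `sm(f' ≫ π) ⊆ sm(f')` for `π` unramified (`smoothLocus_comp_le`, stalkwise
  `Algebra.FormallySmooth.of_restrictScalars`);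
* `f'` is smooth over `π⁻¹(V)` when `f` is smooth over `V` (`smooth_of_smooth_comp`), and
  `π(η_{Y'})` is the generic point side: it lies in every non-empty open of `ℙ^d` — (vi) c);
* `f'|_{Z'}` is finite and generically étale by cancellation of the finite étale `π`
  (`DeJong1996.IsFiniteGenericallyEtaleOn.of_comp_eq`) — (vi) d).

Results:

* `DeJong1996.IsLemma411Fibration.situationVI_normalization` — in the situation of 4.12, the
  pair `(X', φ⁻¹Z)` with `f' : X' → Y'` is in situation (vi);
* `DeJong1996FibrationReduction.of_lemma411_of_stein` — `DeJong1996FibrationReduction` from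
  Lemma 4.11 (`DeJong1996Lemma411`), Zariski's connectedness theorem and the finite-étaleness of
  the Stein finite part (2.8 and the projectivity of blow-ups being proved in the tree);
* `DeJong1996FibrationReduction.of_threeLeaves` — the same from the THREE named facts still open
  below 4.11–4.12: `DeJong1996Lemma411VertexChoice` (generic projections and Bertini),
  `steinFactorization_geometricallyConnected` (Stacks 03H2 (1)) and
  `DeJong1996SteinFactorizationEtale` (de Jong's sentence "`Y' → ℙ^{d-1}` is (finite) étale");
  the blow-up of the vertex (`DeJong1996VertexBlowupProjection_holds`), the construction facts
  of 4.11 and 2.8 are discharged in the tree. `EtaleCoverHyperplaneSectionConnected` is no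
  longer needed for Thm. 4.1.

## Sources

* A. J. de Jong, *Smoothness, semi-stability and alterations*, Publ. Math. IHÉS 83 (1996) 51–93:
  Lemma 4.11 and 4.12, pp. 67–69 (the parenthetical remark: p. 68, last lines). [DeJong1996]
* The Stacks Project, Tags 035H, 03H0, 03H2 (Stein factorisation), 02GW (étale cancellation).
* U. Görtz, T. Wedhorn, *Algebraic Geometry I*, Thm. 13.84 (finite over `ℙⁿ` ⇒ projective).
-/

noncomputable section

open CategoryTheory CategoryTheory.Limits AlgebraicGeometry TopologicalSpace Topology

namespace Literature.AlgebraicGeometry.Resolution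

universe u

open Literature.AlgebraicGeometry.Motives (projectiveSpace IsProjectiveOver)
open Literature.AlgebraicGeometry.Morphisms (steinFactorization_geometricallyConnected)

/-! ## Topology: irreducible components of an open and closed subspace -/

section Topology

variable {A B : Type*} [TopologicalSpace A] [TopologicalSpace B]

/-- The image of an irreducible component under an open embedding with closed range (the
inclusion of an open and closed subspace) is an irreducible component: the component `t` of `B`
containing `e(C)` pulls back to an irreducible set containing `C`, hence equal to `C`, and `t`,
being connected and meeting the open and closed `range e`, lies inside it. [folklore] -/
theorem image_mem_irreducibleComponents_of_isOpenEmbedding {e : A → B} (he : IsOpenEmbedding e)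
    (hc : IsClosed (Set.range e)) {C : Set A} (hC : C ∈ irreducibleComponents A) :
    e '' C ∈ irreducibleComponents B := by
  have hCi : IsIrreducible (e '' C) := hC.1.image e he.continuous.continuousOn
  obtain ⟨t, ht, hCt⟩ := exists_mem_irreducibleComponents_subset_of_isIrreducible _ hCi
  have hne : (t ∩ Set.range e).Nonempty := by
    obtain ⟨a, ha⟩ := hC.1.nonempty
    exact ⟨e a, hCt ⟨a, ha, rfl⟩, a, rfl⟩
  have h1 : e ⁻¹' t ∈ irreducibleComponents A := preimage_mem_irreducibleComponents ht he hne
  have h2 : C ⊆ e ⁻¹' t := fun a ha => hCt ⟨a, ha, rfl⟩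
  have h3 : e ⁻¹' t ⊆ C := hC.2 h1.1 h2
  have h4 : t ⊆ Set.range e :=
    ht.1.isPreirreducible.isPreconnected.subset_isClopen ⟨hc, he.isOpen_range⟩ hne
  have h5 : e '' C = t := by
    rw [Set.Subset.antisymm h2 h3, Set.image_preimage_eq_inter_range, Set.inter_eq_left.mpr h4]
  rw [h5]
  exact ht

/-- An embedding restricts to a homeomorphism from any subset onto its image, so the two have
the same topological Krull dimension. [folklore] -/
theorem topologicalKrullDim_image_of_isEmbedding {e : A → B} (he : IsEmbedding e) (C : Set A) :
    topologicalKrullDim (e '' C) = topologicalKrullDim C := by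
  have hmem : ∀ c : C, (fun c : C => e c) c ∈ e '' C := fun c => ⟨c, c.2, rfl⟩
  have hg : IsHomeomorph (Set.codRestrict (fun c : C => e c) (e '' C) hmem) := by
    rw [isHomeomorph_iff_isEmbedding_surjective]
    refine ⟨(he.comp IsEmbedding.subtypeVal).codRestrict (e '' C) hmem, ?_⟩
    rintro ⟨_, c, hc, rfl⟩
    exact ⟨⟨c, hc⟩, rfl⟩
  exact (IsHomeomorph.topologicalKrullDim_eq _ hg).symm

end Topology

/-! ## Smoothness and composition with an unramified morphism -/

/-- Ring maps `R → S → T`: if `R → T` is formally smooth and `R → S` is formally unramified,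
then `S → T` is formally smooth (Mathlib's `Algebra.FormallySmooth.of_restrictScalars`).
[folklore] -/
theorem formallySmooth_of_comp_of_formallyUnramified {R S T : Type*} [CommRing R] [CommRing S]
    [CommRing T] {f : R →+* S} {g : S →+* T} (h : (g.comp f).FormallySmooth)
    (hf : f.FormallyUnramified) : g.FormallySmooth := by
  algebraize [f, g, g.comp f]
  exact Algebra.FormallySmooth.of_restrictScalars (R := R) (A := S) (B := T)

/-- **The smooth locus only grows along an unramified second factor**: for `f' : X → Y'` and
`π : Y' → S` formally unramified, `sm(f' ≫ π) ⊆ sm(f')` — stalkwise, `𝒪_{S, s} → 𝒪_{Y', y'}` is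
formally unramified and `𝒪_{S, s} → 𝒪_{X, x}` formally smooth (Stacks 02K5 for `π` étale).
[folklore] -/
theorem smoothLocus_comp_le {X Y' S : Scheme.{u}} (f' : X ⟶ Y') (π : Y' ⟶ S)
    [LocallyOfFinitePresentation f'] [LocallyOfFinitePresentation (f' ≫ π)]
    [FormallyUnramified π] : (f' ≫ π).smoothLocus ≤ f'.smoothLocus := by
  intro x hx
  have e := Scheme.Hom.stalkMap_comp f' π x
  have hx' : ((f' ≫ π).stalkMap x).hom.FormallySmooth := hx
  rw [e] at hx'
  exact formallySmooth_of_comp_of_formallyUnramified (f := (π.stalkMap (f' x)).hom)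
    (g := (f'.stalkMap x).hom) hx' (FormallyUnramified.stalkMap π (f' x))

/-- The same for `f' ≫ π = f` given as an equation. [folklore] -/
theorem smoothLocus_le_of_comp_eq {X Y' S : Scheme.{u}} {f' : X ⟶ Y'} {π : Y' ⟶ S} {f : X ⟶ S}
    (hfac : f' ≫ π = f) [LocallyOfFinitePresentation f'] [LocallyOfFinitePresentation f]
    [FormallyUnramified π] : (f.smoothLocus : Set X) ⊆ f'.smoothLocus := by
  subst hfac
  exact smoothLocus_comp_le f' π

/-- **Cancellation of an unramified factor for smoothness**: if `f' ≫ π` is smooth and `π` is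
formally unramified then `f'` is smooth (`f'` is locally of finite presentation) — the smooth
locus of `f'` contains that of `f' ≫ π`, which is everything (Stacks 02K5). [folklore] -/
theorem smooth_of_smooth_comp {X Y' S : Scheme.{u}} (f' : X ⟶ Y') (π : Y' ⟶ S)
    [LocallyOfFinitePresentation f'] [FormallyUnramified π] [Smooth (f' ≫ π)] : Smooth f' := by
  rw [← Scheme.Hom.smoothLocus_eq_top_iff, ← top_le_iff]
  calc (⊤ : X.Opens) = (f' ≫ π).smoothLocus := ((f' ≫ π).smoothLocus_eq_top).symm
    _ ≤ f'.smoothLocus := smoothLocus_comp_le f' π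

/-- If `f = f' ≫ π` is smooth over the open `V ⊆ S` and `π` is étale, then `f'` is smooth over
`π⁻¹(V)`: `f ∣_ V = (f' ∣_ π⁻¹V) ≫ (π ∣_ V)`. [folklore] -/
theorem smooth_morphismRestrict_of_comp_eq {X Y' S : Scheme.{u}} {f' : X ⟶ Y'} {π : Y' ⟶ S}
    {f : X ⟶ S} (hfac : f' ≫ π = f) (V : S.Opens) [LocallyOfFinitePresentation f'] [Etale π]
    [hV : Smooth (f ∣_ V)] : Smooth (f' ∣_ (π ⁻¹ᵁ V)) := by
  subst hfac
  haveI : Smooth (f' ∣_ (π ⁻¹ᵁ V) ≫ π ∣_ V) := by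
    rw [← morphismRestrict_comp]
    exact hV
  exact smooth_of_smooth_comp (f' ∣_ (π ⁻¹ᵁ V)) (π ∣_ V)

/-! ## Fibres of `f'` inside fibres of `f' ≫ π` for `π` quasi-finite -/

namespace DeJong1996

section Fibres

variable {X Y' S : Scheme.{u}} (f' : X ⟶ Y') (π : Y' ⟶ S) (y' : Y')

/-- `f'⁻¹{y'} ⊆ (f' ≫ π)⁻¹{π y'}`. [folklore] -/
theorem preimage_singleton_subset_preimage_comp :
    f' ⁻¹' {y'} ⊆ (f' ≫ π) ⁻¹' {π y'} := by
  intro x hx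
  simp only [Set.mem_preimage, Set.mem_singleton_iff] at hx ⊢
  rw [Scheme.Hom.comp_apply, hx]

/-- For `π` quasi-finite, `f'⁻¹{y'}` is open in `(f' ≫ π)⁻¹{π y'}`: the fibre `π⁻¹{π y'}` is
discrete, so `{y'} = W ∩ π⁻¹{π y'}` for an open `W`, and `f'⁻¹{y'} = f'⁻¹W ∩ (f' ≫ π)⁻¹{π y'}`.
[folklore] -/
theorem isOpen_preimage_val_preimage_singleton [LocallyQuasiFinite π] :
    IsOpen ((Subtype.val : (f' ≫ π) ⁻¹' {π y'} → X) ⁻¹' (f' ⁻¹' {y'})) := by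
  obtain ⟨W, hWo, hW⟩ := isDiscrete_iff_forall_mem_exists_isOpen.mp
    (π.isDiscrete_preimage_singleton (π y')) y' rfl
  have : (Subtype.val : (f' ≫ π) ⁻¹' {π y'} → X) ⁻¹' (f' ⁻¹' {y'}) =
      (fun x => f' x.1) ⁻¹' W := by
    ext ⟨x, hx⟩
    have hx' : f' x ∈ π ⁻¹' {π y'} := by
      simpa only [Set.mem_preimage, Set.mem_singleton_iff, Scheme.Hom.comp_apply] using hx
    simp only [Set.mem_preimage, Set.mem_singleton_iff]
    constructor
    · intro h
      have : f' x ∈ W ∩ π ⁻¹' {π y'} := by rw [hW]; exact h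
      exact this.1
    · intro h
      have : f' x ∈ W ∩ π ⁻¹' {π y'} := ⟨h, hx'⟩
      rw [hW] at this
      exact this
  rw [this]
  exact hWo.preimage (f'.continuous.comp continuous_subtype_val)

/-- … and closed there, by the same argument with a closed `W`. [folklore] -/
theorem isClosed_preimage_val_preimage_singleton [LocallyQuasiFinite π] :
    IsClosed ((Subtype.val : (f' ≫ π) ⁻¹' {π y'} → X) ⁻¹' (f' ⁻¹' {y'})) := by
  obtain ⟨W, hWc, hW⟩ := isDiscrete_iff_forall_mem_exists_isClosed.mp
    (π.isDiscrete_preimage_singleton (π y')) {y'} (by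
      rintro _ rfl
      exact rfl)
  have : (Subtype.val : (f' ≫ π) ⁻¹' {π y'} → X) ⁻¹' (f' ⁻¹' {y'}) =
      (fun x => f' x.1) ⁻¹' W := by
    ext ⟨x, hx⟩
    have hx' : f' x ∈ π ⁻¹' {π y'} := by
      simpa only [Set.mem_preimage, Set.mem_singleton_iff, Scheme.Hom.comp_apply] using hx
    simp only [Set.mem_preimage, Set.mem_singleton_iff]
    constructor
    · intro h
      have : f' x ∈ W ∩ π ⁻¹' {π y'} := by rw [hW]; exact h
      exact this.1
    · intro h
      have : f' x ∈ W ∩ π ⁻¹' {π y'} := ⟨h, hx'⟩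
      rw [hW] at this
      exact this
  rw [this]
  exact hWc.preimage (f'.continuous.comp continuous_subtype_val)

/-- **The fibre `f'⁻¹(y')` embeds into the fibre `(f' ≫ π)⁻¹(π y')` as an open and closed
subspace** (for `π` quasi-finite), compatibly with the embeddings into `X`: the comparison map
is `fiberHomeo⁻¹ ∘ inclusion ∘ fiberHomeo` through the homeomorphisms of the scheme-theoretic
fibres with the set-theoretic ones `f'⁻¹{y'} ⊆ (f' ≫ π)⁻¹{π y'}`. [folklore] -/
theorem exists_isOpenEmbedding_fiber_comp [LocallyQuasiFinite π] :
    ∃ e : ↥(f'.fiber y') → ↥((f' ≫ π).fiber (π y')),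
      IsOpenEmbedding e ∧ IsClosed (Set.range e) ∧
        ∀ x, (f' ≫ π).fiberι (π y') (e x) = f'.fiberι y' x := by
  have hsub := preimage_singleton_subset_preimage_comp f' π y'
  refine ⟨((f' ≫ π).fiberHomeo (π y')).symm ∘ Set.inclusion hsub ∘ f'.fiberHomeo y', ?_, ?_, ?_⟩
  · exact (((f' ≫ π).fiberHomeo (π y')).symm.isOpenEmbedding.comp
      (IsOpenEmbedding.inclusion hsub (isOpen_preimage_val_preimage_singleton f' π y'))).comp
      (f'.fiberHomeo y').isOpenEmbedding
  · exact ((((f' ≫ π).fiberHomeo (π y')).symm.isClosedEmbedding.comp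
      (IsClosedEmbedding.inclusion hsub (isClosed_preimage_val_preimage_singleton f' π y'))).comp
      (f'.fiberHomeo y').isClosedEmbedding).isClosed_range
  · intro x
    simp only [Function.comp_apply, Scheme.Hom.fiberι_fiberHomeo_symm,
      Scheme.Hom.fiberHomeo_apply]

/-- **Irreducible components of `f'⁻¹(y')` are irreducible components of `f⁻¹(π y')`** when
`f = f' ≫ π` with `π` quasi-finite (the former fibre is open and closed in the latter), with the
same dimension. [folklore] -/
theorem exists_mem_irreducibleComponents_fiber_comp [LocallyQuasiFinite π] {f : X ⟶ S}
    (hfac : f' ≫ π = f)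
    {C : Set ↥(f'.fiber y')} (hC : C ∈ irreducibleComponents ↥(f'.fiber y')) :
    ∃ C₀ ∈ irreducibleComponents ↥(f.fiber (π y')),
      topologicalKrullDim C₀ = topologicalKrullDim C := by
  subst hfac
  obtain ⟨e, he, hc, -⟩ := exists_isOpenEmbedding_fiber_comp f' π y'
  exact ⟨_, image_mem_irreducibleComponents_of_isOpenEmbedding he hc hC,
    topologicalKrullDim_image_of_isEmbedding he.isEmbedding C⟩

/-- **Density in fibres passes from `f = f' ≫ π` to `f'`** (`π` quasi-finite): if `D ⊆ X` is
dense in the fibre `f⁻¹(π y')` then it is dense in its open subspace `f'⁻¹(y')`. [folklore] -/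
theorem dense_preimage_fiberι_of_comp_eq [LocallyQuasiFinite π] {f : X ⟶ S}
    (hfac : f' ≫ π = f) {D : Set X} (hD : Dense ((f.fiberι (π y')) ⁻¹' D)) :
    Dense ((f'.fiberι y') ⁻¹' D) := by
  subst hfac
  obtain ⟨e, he, -, hcomm⟩ := exists_isOpenEmbedding_fiber_comp f' π y'
  have : (f'.fiberι y') ⁻¹' D = e ⁻¹' (((f' ≫ π).fiberι (π y')) ⁻¹' D) := by
    ext x
    simp only [Set.mem_preimage, hcomm]
  rw [this]
  exact hD.preimage he.isOpenMap

end Fibres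

/-! ## (vi) d) along a finite étale second factor -/

/-- **(vi) d) passes from `f = f' ≫ π` to `f'`** for `π` étale and separated: `f|_Z` finite
⇒ `f'|_Z` finite (`IsFinite.of_comp`), and `f|_Z` étale on a dense open `U ⊆ Z` ⇒ `f'|_Z` étale
on `U` (Stacks 02GW, `Etale.of_comp`). [folklore] -/
theorem IsFiniteGenericallyEtaleOn.of_comp_eq {X Y' S : Scheme.{u}} {f' : X ⟶ Y'} {π : Y' ⟶ S}
    {f : X ⟶ S} (hfac : f' ≫ π = f) [Etale π] [IsSeparated π] {Z : Set X}
    (h : IsFiniteGenericallyEtaleOn f Z) : IsFiniteGenericallyEtaleOn f' Z := by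
  subst hfac
  obtain ⟨hfin, U, hU, het⟩ := h
  refine ⟨?_, U, hU, ?_⟩
  · rw [← Category.assoc] at hfin
    haveI := hfin
    exact IsFinite.of_comp _ π
  · haveI : Etale ((U.ι ≫ (Scheme.IdealSheafData.vanishingIdeal
        ⟨closure Z, isClosed_closure⟩).subschemeι ≫ f') ≫ π) := by
      simpa only [Category.assoc] using het
    exact Etale.of_comp _ π

/-! ## Situation (vi) over the Stein base -/

variable {k : Type u} [Field k] [IsAlgClosed k] {X : Scheme.{u}} {fX : X ⟶ Spec (.of k)}
  {Z : Set X} {d : ℕ} {X' : Scheme.{u}} {φ : X' ⟶ X} {f : X' ⟶ (projectiveSpace d k).left}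

/-- The image of the generic point of an irreducible space under a surjective continuous map lies
in every non-empty open set (it is a dense point). [folklore] -/
theorem apply_genericPoint_mem_of_surjective {Y P : Scheme.{u}} [IrreducibleSpace Y]
    (π : Y ⟶ P) (hπ : Function.Surjective π) (V : P.Opens) (hV : (V : Set P).Nonempty) :
    π (genericPoint Y) ∈ V := by
  have hdense : Dense ({π (genericPoint Y)} : Set P) := by
    rw [dense_iff_closure_eq]
    apply Set.eq_univ_of_univ_subset
    calc (Set.univ : Set P) = π '' Set.univ := (Set.image_univ_of_surjective hπ).symm
      _ = π '' closure {genericPoint Y} := by rw [genericPoint_closure]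
      _ ⊆ closure (π '' {genericPoint Y}) := image_closure_subset_closure_image π.continuous
      _ = closure {π (genericPoint Y)} := by rw [Set.image_singleton]
  obtain ⟨z, hzV, hz⟩ := hdense.inter_open_nonempty V V.isOpen hV
  rw [Set.mem_singleton_iff] at hz
  rwa [hz] at hzV

/-- **de Jong 1996, 4.12 with "ℙ^{d-1} replaced by `Y'`": the pair `(X', φ⁻¹Z)` is fibred in
curves over the Stein base.** In the situation of 4.12 — `k` algebraically closed, `(X, Z)` a
normal projective pair of dimension `d + 1`, `φ : X' → X`, `f : X' → ℙ^d_k` as provided by Lemma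
4.11 with d) a smooth fibre — let `X' → Y' → ℙ^d` be the Stein factorisation
(`f.toNormalization ≫ f.fromNormalization = f`). Granting Zariski's connectedness theorem
(`steinFactorization_geometricallyConnected`) and "`Y' → ℙ^{d-1}` is (finite) étale"
(`DeJong1996SteinFactorizationEtale`), the `k`-morphism `f' : X' → Y'` to the projective
variety `Y'` has (vi) a)–d): all fibres non-empty, geometrically connected, equidimensional of
dimension `1`, smooth locus dense in all fibres, smooth generic fibre (2.8:
`DeJong1996SmoothOverOpen_holds`), and `f'|_{φ⁻¹Z}` finite and generically étale. "(The reader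
may circumvent this result by replacing `ℙ^{d-1}` by `Y'`.)" [cite: DeJong1996, 4.12, pp. 68–69] -/
theorem IsLemma411Fibration.exists_isCurveFibration_normalization
    (hS : steinFactorization_geometricallyConnected.{u})
    (hE : DeJong1996SteinFactorizationEtale.{u}) (hP : NormalProjectivePair fX Z)
    (hd : topologicalKrullDim X = (d + 1 : ℕ)) (hF : IsLemma411Fibration fX Z d φ f)
    (hy : ∃ y : ↥(projectiveSpace d k).left, Smooth (f.fiberToSpecResidueField y)) :
    ∃ (Y : Scheme.{u}) (_ : IsIntegral Y) (g : Y ⟶ Spec (.of k)) (f₁ : X' ⟶ Y),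
      IsProjectiveOver (Over.mk g) ∧ f₁ ≫ g = φ ≫ fX ∧ IsCurveFibration f₁ ∧
        IsFiniteGenericallyEtaleOn f₁ (φ ⁻¹' Z) := by
  haveI := hP.isIntegral
  haveI := hP.isProper
  haveI := (hF.isAlteration hP hd).isIntegral
  haveI : IsProper f := hF.isProper hP hd
  haveI : IsProper (projectiveSpace d k).hom := Motives.isProper_projectiveSpace d k
  -- the Stein factorisation `X' → Y' → ℙ^d`: `π` is finite étale, `f₁` geometrically connected
  obtain ⟨hfin, het⟩ := hE k X fX Z d X' φ f hP hd hF hy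
  haveI := hfin
  haveI := het
  have hfac : f.toNormalization ≫ f.fromNormalization = f := f.toNormalization_fromNormalization
  -- 2.8: `f` is smooth over a non-empty open `V`
  obtain ⟨V, hVne, hVsm⟩ := DeJong1996SmoothOverOpen_holds k X fX Z d X' φ f hP hd hF hy
  haveI := hVsm
  -- notation
  set Y := f.normalization with hYdef
  set π : Y ⟶ (projectiveSpace d k).left := f.fromNormalization with hπdef
  set f₁ : X' ⟶ Y := f.toNormalization with hf₁def
  -- `Y` is a projective variety over `k`
  let g : Y ⟶ Spec (.of k) := π ≫ (projectiveSpace d k).hom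
  have hproj : IsProjectiveOver (Over.mk g) := by
    haveI : IsProper (Over.mk g).hom := by
      change IsProper (π ≫ (projectiveSpace d k).hom)
      infer_instance
    haveI : IsFinite (Over.homMk π rfl : Over.mk g ⟶ projectiveSpace d k).left := by
      change IsFinite π
      infer_instance
    exact Motives.isProjectiveOver_of_isFinite (Z := Over.mk g) (Over.homMk π rfl)
  -- `f₁` is locally of finite presentation (`Y` is locally Noetherian), proper and surjective
  haveI : IsLocallyNoetherian Y := LocallyOfFiniteType.isLocallyNoetherian g
  haveI : LocallyOfFinitePresentation f := hF.locallyOfFinitePresentation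
  haveI : LocallyOfFiniteType (f₁ ≫ π) := by rw [hfac]; infer_instance
  haveI : LocallyOfFiniteType f₁ := locallyOfFiniteType_of_comp f₁ π
  haveI hlfp : LocallyOfFinitePresentation f₁ :=
    LocallyOfFinitePresentation.iff_locallyOfFiniteType.mpr inferInstance
  haveI : IsProper (f₁ ≫ π) := by rw [hfac]; infer_instance
  haveI : IsProper f₁ := IsProper.of_comp f₁ π
  have hsurj₁ : Surjective f₁ := ⟨by
    have hc : IsClosed (Set.range f₁) := f₁.isClosedMap.isClosed_range
    have hdn : Dense (Set.range f₁) := f₁.denseRange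
    intro y
    have : y ∈ closure (Set.range f₁) := hdn y
    rwa [hc.closure_eq] at this⟩
  -- `π` is surjective (as `f` is, (ii) a)), so `π(η_Y)` lies in `V`
  haveI : Surjective f := hF.surjective
  have hπsurj : Function.Surjective π := fun s => by
    obtain ⟨x, hx⟩ := f.surjective s
    exact ⟨f₁ x, by rw [← Scheme.Hom.comp_apply, hfac]; exact hx⟩
  have hη : genericPoint Y ∈ π ⁻¹ᵁ V :=
    apply_genericPoint_mem_of_surjective π hπsurj V hVne
  haveI : Smooth (f₁ ∣_ (π ⁻¹ᵁ V)) := smooth_morphismRestrict_of_comp_eq hfac V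
  refine ⟨Y, inferInstance, g, f₁, hproj, ?_, ?_, IsFiniteGenericallyEtaleOn.of_comp_eq hfac
    hF.isFiniteGenericallyEtaleOn⟩
  · -- `f₁` is over `k`
    change f₁ ≫ π ≫ (projectiveSpace d k).hom = φ ≫ fX
    rw [← Category.assoc, hfac, hF.comp_hom]
  · exact
      { locallyOfFinitePresentation := hlfp
        surjective := hsurj₁
        geometricallyConnected := hS f
        topologicalKrullDim_eq_one := fun y C hC => by
          obtain ⟨C₀, hC₀, hdim⟩ := exists_mem_irreducibleComponents_fiber_comp f₁ π y hfac hC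
          rw [← hdim]
          exact hF.topologicalKrullDim_eq_one (π y) C₀ hC₀
        dense_preimage_smoothLocus := fun y => by
          have h1 := hF.dense_preimage_smoothLocus (π y)
          have h2 : ((@Scheme.Hom.smoothLocus _ _ f hF.locallyOfFinitePresentation : X'.Opens) :
              Set X') ⊆ (f₁.smoothLocus : Set X') := smoothLocus_le_of_comp_eq hfac
          exact dense_preimage_fiberι_of_comp_eq f₁ π y hfac (h1.mono (Set.preimage_mono h2))
        smooth_fiberToSpecResidueField_genericPoint :=
          smooth_fiberToSpecResidueField_of_mem f₁ (π ⁻¹ᵁ V) hη }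

/-- **In the situation of 4.12, `(X', φ⁻¹Z)` is in situation (vi) with base the Stein base `Y'`**
(de Jong 1996, 4.12: "Note that `X'` is normal also. […] By replacing `(X, Z)` by `(X', Z')`, see
4.4 and 4.10, we may assume we have (i)–(v) and […] (vi)"), granting Zariski's connectedness
theorem and the finite-étaleness of `Y' → ℙ^d`; (iii) for `X'` is the projectivity of blow-ups
(`BlowupProjectiveOverField_holds`), (iv) is 4.10 (`IsEffectiveCartier.comap_of_isDominant`), (v)
is `IsBlowup.isIntegrallyClosed_stalk_of_finite`. [cite: DeJong1996, 4.12, pp. 68–69] -/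
theorem IsLemma411Fibration.situationVI_normalization
    (hS : steinFactorization_geometricallyConnected.{u})
    (hE : DeJong1996SteinFactorizationEtale.{u}) (hP : NormalProjectivePair fX Z)
    (hd : topologicalKrullDim X = (d + 1 : ℕ)) (hF : IsLemma411Fibration fX Z d φ f)
    (hy : ∃ y : ↥(projectiveSpace d k).left, Smooth (f.fiberToSpecResidueField y)) :
    SituationVI (φ ≫ fX) (φ ⁻¹' Z) := by
  haveI := hP.isIntegral
  haveI := hP.isProper
  haveI : IsLocallyNoetherian X := LocallyOfFiniteType.isLocallyNoetherian fX
  have h1 : (1 : WithBot ℕ∞) ≤ topologicalKrullDim X := by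
    rw [hd]
    exact_mod_cast Nat.succ_le_succ (Nat.zero_le d)
  obtain ⟨S, hS', hSf, hSc, hSreg, -, hblow⟩ := hF.exists_isBlowup
  have hJ := vanishingIdeal_ne_bot_of_forall_isClosed h1 hS' hSc
  have hφ : IsAlteration φ := isAlteration_of_isBlowup hblow hJ
  haveI := hφ.isIntegral
  haveI := hφ.isProper
  haveI := hφ.isDominant
  obtain ⟨D, hD, hDZ⟩ := hP.exists_isEffectiveCartier
  exact
    { normalProjectivePair :=
        { isIntegral := inferInstance
          isProjectiveOver := BlowupProjectiveOverField_holds k X X' fX _ φ inferInstance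
            hP.isProjectiveOver hJ hblow
          exists_isEffectiveCartier := ⟨D.comap φ, hD.comap_of_isDominant φ, by
            rw [Scheme.IdealSheafData.support_comap, TopologicalSpace.Closeds.coe_preimage, hDZ]⟩
          isIntegrallyClosed := fun x' => hblow.isIntegrallyClosed_stalk_of_finite
            (isOpen_regularLocus_of_locallyOfFiniteType_perfectField fX) hP.isIntegrallyClosed hS'
            hSf hSc hSreg x' }
      exists_isCurveFibration := hF.exists_isCurveFibration_normalization hS hE hP hd hy }

end DeJong1996

/-! ## The assemblies -/

/-- **`DeJong1996FibrationReduction` (de Jong 1996, Lemma 4.11 with 4.12) from Lemma 4.11,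
Zariski's connectedness theorem and the finite-étaleness of the Stein finite part — WITHOUT
`π₁(ℙ^{d-1}) = 0`**, following the source's own remark "(The reader may circumvent this result
by replacing `ℙ^{d-1}` by `Y'`.)": write `dim X = d + 1`, apply 4.11 with d), and take for the
base of (vi) the Stein base `Y'` (`DeJong1996.IsLemma411Fibration.situationVI_normalization`);
`φ` is a generically étale alteration (`isAlteration_of_isBlowup`,
`isGenericallyEtale_of_isBlowup`). 2.8 (`DeJong1996SmoothOverOpen_holds`) and the projectivity
of blow-ups (`BlowupProjectiveOverField_holds`) are proved in the tree.
[cite: DeJong1996, Lemma 4.11 and 4.12, pp. 67–69] -/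
theorem DeJong1996FibrationReduction.of_lemma411_of_stein (h411 : DeJong1996Lemma411.{u})
    (hS : steinFactorization_geometricallyConnected.{u})
    (hE : DeJong1996SteinFactorizationEtale.{u}) : DeJong1996FibrationReduction.{u} := by
  intro k _ _ X fX Z hP h1
  haveI := hP.isIntegral
  haveI := hP.isProper
  haveI : IsLocallyNoetherian X := LocallyOfFiniteType.isLocallyNoetherian fX
  haveI : CompactSpace X := QuasiCompact.compactSpace_of_compactSpace fX
  obtain ⟨d, hd⟩ := exists_nat_topologicalKrullDim_eq_succ fX h1
  -- Lemma 4.11 with d) (`X` is normal)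
  obtain ⟨X', φ, f, hF, hy⟩ := (h411 k X fX Z d inferInstance hP.isProjectiveOver
    hP.exists_isEffectiveCartier hd).2 hP.isIntegrallyClosed
  obtain ⟨S, hS', -, hSc, -, -, hblow⟩ := hF.exists_isBlowup
  have hJ := vanishingIdeal_ne_bot_of_forall_isClosed h1 hS' hSc
  exact ⟨X', φ, isAlteration_of_isBlowup hblow hJ, isGenericallyEtale_of_isBlowup hblow,
    hF.situationVI_normalization hS hE hP hd hy⟩

/-- **4.11–4.12 from its THREE open leaves**: the generic projection of the proof of Lemma 4.11
with its Bertini conclusions, normalised at the vertex (`DeJong1996Lemma411VertexChoice`),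
Zariski's connectedness theorem for the Stein factorisation
(`steinFactorization_geometricallyConnected`, Stacks 03H2 (1)) and de Jong's sentence "`Y' →
ℙ^{d-1}` is (finite) étale" (`DeJong1996SteinFactorizationEtale`). The blow-up of `ℙ^{d+1}` in
the vertex with its projection (`DeJong1996VertexBlowupProjection_holds`), the blow-up of `X` in
`π⁻¹(p)`, the fibre dimension, the density of the smooth locus
(`DeJong1996Lemma411Blowup_holds`, `DeJong1996Lemma411FibreDimension_holds`,
`DeJong1996Lemma411SmoothLocusDense_holds`), 2.8 and the projectivity of blow-ups are proved in
the tree, and `π₁(ℙ^{d-1}) = 0` is circumvented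
(`DeJong1996FibrationReduction.of_lemma411_of_stein`).
[cite: DeJong1996, Lemma 4.11 and 4.12, pp. 67–69] -/
theorem DeJong1996FibrationReduction.of_threeLeaves (hC : DeJong1996Lemma411VertexChoice.{u})
    (hS : steinFactorization_geometricallyConnected.{u})
    (hE : DeJong1996SteinFactorizationEtale.{u}) : DeJong1996FibrationReduction.{u} :=
  DeJong1996FibrationReduction.of_lemma411_of_stein
    (DeJong1996Lemma411.of_vertexBlowupProjection_of_vertexChoice_of_construction
      DeJong1996VertexBlowupProjection_holds hC DeJong1996Lemma411Blowup_holds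
      DeJong1996Lemma411FibreDimension_holds DeJong1996Lemma411SmoothLocusDense_holds)
    hS hE

end Literature.AlgebraicGeometry.Resolution

end
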